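import Literature.NumberTheory.Transcendental.NesterenkoMultiplicityTheorem
import Literature.NumberTheory.Transcendental.NesterenkoMultiplicityValuedField
import Literature.NumberTheory.Transcendental.NesterenkoMultiplicityMacaulay
import Literature.NumberTheory.Transcendental.NesterenkoEliminationCor49KAlgClosed
import HarnessLib

/-!
# Nesterenko's multiplicity estimate (LNM 1752 Ch. 10 Thm 1.1): the residual hypotheses — proofs only

`Literature/NumberTheory/Transcendental/NesterenkoMultiplicityResidual.lean` — proofs only (no
definitions, no named facts). `NesterenkoMultiplicityTheorem.thm_1_1_of_toolkit` proves
`NesterenkoPhilippon2001_ch10_thm_1_1` from the hypothesis bundle `CzToolkit m L hgt hgtP γ₁` for some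
valued field `L` with an isometric copy of `ℂ⟦z⟧`. Three ingredients are now in the tree unconditionally:
the valued field `L = 𝒦 = CzBar` with `ι = iota`, `‖ι φ‖ = e^{−ord φ}` (`NesterenkoMultiplicityValuedField`),
Macaulay's theorem in the toolkit's form (`macaulay_field`, `NesterenkoMultiplicityMacaulay`) and
Ch. 3 Cor. 4.9 for algebraically closed `L` (`NesterenkoK.cor_4_9_field`,
`NesterenkoEliminationCor49KAlgClosed`). This file records what is LEFT, as one explicit hypothesis:
heights `h` on ideals and forms of `ℂ(z)[x₀, …, x_m]` with `h ≥ 0`, `h(Q) ≤ deg_z Q`, a constant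
`γ₁ ≥ 1`, and the printed results Ch. 10 Lemma 3.1 [Nes3], Lemma 3.5 [Nes6], Ch. 3 Prop. 4.7 2),
Prop. 4.8, Prop. 4.11, Prop. 4.13 over `K = ℂ(z)` at `L = 𝒦` — `thm_1_1_of_heights`. The sharper form for the book's concrete heights over `ℂ(z)` is in
`NesterenkoMultiplicityResidualBook.lean`.

## References

* [NesterenkoPhilippon2001] Yu. V. Nesterenko, P. Philippon (eds.), *Introduction to Algebraic
  Independence Theory*, LNM 1752, Springer 2001, Ch. 10 Thm. 1.1 (p. 150), §§2–4; Ch. 3 §4.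
-/

noncomputable section

open MvPolynomial
open scoped Polynomial

namespace Literature.NumberTheory.Transcendental

namespace NesterenkoMultiplicity

open Literature.NumberTheory.Transcendental.NesterenkoK

attribute [local instance] MvPolynomial.gradedAlgebra

/-- **Theorem 1.1 of LNM 1752 Ch. 10 from the residual hypotheses**: if for every `m ≥ 1` there are
heights `hgt`, `hgtP` and a constant `γ₁` on `ℂ(z)[x₀, …, x_m]` satisfying the printed Ch. 10 Lemma 3.1,
Lemma 3.5 and Ch. 3 Prop. 4.7 2), 4.8, 4.11, 4.13 over `K = ℂ(z)` at the valued field `𝒦 = CzBar`, then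
`NesterenkoPhilippon2001_ch10_thm_1_1` holds (the remaining fields `cor_4_9`, `macaulay` of `CzToolkit`
and the data `(L, ι, hι)` being theorems/constructions of the tree).
[cite: NesterenkoPhilippon2001, Ch. 10 Thm. 1.1 (p. 150) and §§2–4 (pp. 152–162)] -/
theorem thm_1_1_of_heights
    (H : ∀ m : ℕ, 1 ≤ m → ∃ (hgt : Ideal (Kx m) → ℕ → ℝ) (hgtP : Kx m → ℝ) (γ₁ : ℝ),
        -- hgt_nonneg
        (∀ (I : Ideal (Kx m)) (r : ℕ), 0 ≤ hgt I r) ∧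
        -- hgtP_nonneg
        (∀ P : Kx m, 0 ≤ hgtP P) ∧
        -- hgtP_toK_le
        (∀ Q : Czx m, hgtP (toK Q) ≤ zDeg Q) ∧
        -- one_le_gamma
        (1 ≤ γ₁) ∧
        -- lemma_3_1
        (∀ (r : ℕ) (𝔭 : Ideal (Kx m)), 1 ≤ r → r ≤ m → 𝔭.IsPrime →
        𝔭.IsHomogeneous (homogeneousSubmodule (Fin (m + 1)) (RatFunc ℂ)) → IsUnmixedOfRank 𝔭 r →
        ∀ μ ν : ℕ, 1 ≤ ν →
          (charFn 𝔭 μ ν : ℝ) ≤ γ₁ * (((μ : ℝ) + 1) * (ν : ℝ) ^ (r - 1) * ideg 𝔭 r + (ν : ℝ) ^ r * hgt 𝔭 r)) ∧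
        -- lemma_3_5
        (∀ (r : ℕ) (I J : Ideal (Kx m)) (Q : Czx m) (d : ℕ), 2 ≤ r → r ≤ m →
        I.IsHomogeneous (homogeneousSubmodule (Fin (m + 1)) (RatFunc ℂ)) → IsUnmixedOfRank I r →
        J.IsHomogeneous (homogeneousSubmodule (Fin (m + 1)) (RatFunc ℂ)) → IsUnmixedOfRank J (r - 1) →
        Q.IsHomogeneous d → (∀ 𝔮 ∈ I.associatedPrimes, toK Q ∉ 𝔮) → I ⊔ Ideal.span {toK Q} ≤ J →
          ideg J (r - 1) ≤ ideg I r * d ∧ hgt J (r - 1) ≤ hgt I r * d + ideg I r * zDeg Q) ∧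
        -- prop_4_7_height
        (∀ (r : ℕ) (I : Ideal (Kx m)) (t : Finset (Ideal (Kx m))), 1 ≤ r → r ≤ m →
        I.IsHomogeneous (homogeneousSubmodule (Fin (m + 1)) (RatFunc ℂ)) → IsUnmixedOfRank I r →
        Submodule.IsMinimalPrimaryDecomposition I t →
          ∑ Q ∈ t, (primaryExponent Q : ℝ) * hgt Q.radical r = hgt I r) ∧
        -- prop_4_8
        (∀ (P : Kx m) (d : ℕ), 1 ≤ m → P ≠ 0 → P.IsHomogeneous d → 1 ≤ d →
        IsUnmixedOfRank (Ideal.span {P}) m → ∀ ω : Fin (m + 1) → CzBar, ω ≠ 0 →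
          ideg (Ideal.span {P}) m = d ∧ hgt (Ideal.span {P}) m ≤ hgtP P ∧
            iabs (Ideal.span {P}) m ω ≤ normAt ω P) ∧
        -- prop_4_11
        (∀ (r : ℕ) (𝔭 : Ideal (Kx m)) (Q : Kx m) (d : ℕ), 1 ≤ r → r ≤ m → 𝔭.IsPrime →
        𝔭.IsHomogeneous (homogeneousSubmodule (Fin (m + 1)) (RatFunc ℂ)) → IsUnmixedOfRank 𝔭 r →
        Q.IsHomogeneous d → 1 ≤ d → Q ∉ 𝔭 →
          (2 ≤ r → ∃ J : Ideal (Kx m),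
            J.IsHomogeneous (homogeneousSubmodule (Fin (m + 1)) (RatFunc ℂ)) ∧ IsUnmixedOfRank J (r - 1) ∧
            (projZeros J : Set (Fin (m + 1) → CzBar)) = projZeros (𝔭 ⊔ Ideal.span {Q}) ∧
            ideg J (r - 1) ≤ ideg 𝔭 r * d ∧
            hgt J (r - 1) ≤ hgt 𝔭 r * d + hgtP Q * ideg 𝔭 r ∧
            ∀ ω : Fin (m + 1) → CzBar, ω ≠ 0 →
              iabs J (r - 1) ω ≤ (if rho ω 𝔭 < normAt ω Q then normAt ω Q else iabs 𝔭 r ω) *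
                Real.exp (hgtP Q * ideg 𝔭 r + hgt 𝔭 r * d)) ∧
          (r = 1 → ∀ ω : Fin (m + 1) → CzBar, ω ≠ 0 →
            (1 : ℝ) ≤ (if rho ω 𝔭 < normAt ω Q then normAt ω Q else iabs 𝔭 r ω) *
              Real.exp (hgtP Q * ideg 𝔭 r + hgt 𝔭 r * d))) ∧
        -- prop_4_13
        (∀ (r : ℕ) (I : Ideal (Kx m)), 1 ≤ r → r ≤ m →
        I.IsHomogeneous (homogeneousSubmodule (Fin (m + 1)) (RatFunc ℂ)) → IsUnmixedOfRank I r →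
        ∀ ω : Fin (m + 1) → CzBar, ω ≠ 0 → ∃ β ∈ (projZeros I : Set (Fin (m + 1) → CzBar)),
          projDist ω β ^ ideg I r ≤ (iabs I r ω * Real.exp (hgt I r)) ^ (1 / (r : ℝ)))) :
    NesterenkoPhilippon2001_ch10_thm_1_1 := by
  intro m hm A f _ _ hsol hDP
  obtain ⟨hgt, hgtP, γ₁, h1, h2, h3, h4, h31, h35, h47, h48, h411, h413⟩ := H m hm
  have T : CzToolkit m CzBar hgt hgtP γ₁ :=
    ⟨h1, h2, h3, h4, h31, h35, h47, h48, cor_4_9_field m, h411, h413, macaulay_field (RatFunc ℂ) m⟩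
  exact thm_1_1_of_toolkit_at norm_iota T hm A f hsol hDP

end NesterenkoMultiplicity

end Literature.NumberTheory.Transcendental

end
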